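import Mathlib
import HarnessLib
import Literature.Probability.Process.RootedHardCoreConfig
import Literature.Probability.Process.PointStationaryLaw
import Summits.AtomisticToContinuum.Crystallization.Theorems.ChartedPlanarOrderRigidityDoor
import Summits.AtomisticToContinuum.Crystallization.Theorems.ChartedPlanarOrderMatchedRootBorel

/-!
# Upper semicontinuity of the matching tolerance in the local rubber topology

decomp-a2c · N `stmt-AtomisticToContinuum-26636` · the portmanteau ingredient of the typed certificate edge
`ChartedPlanarOrderRigidityDoor.GapTransfer ν` («closure {¬ matched_ν} ⊆ {¬ matched_ν'}», card §3 of lens-3's RigidityDoor node),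
proved by hand-1 g8 on configuration space `RootedHardCoreConfig E3 δ` (local rubber topology):

* `eventually_matchedAt_of_lt` — if the root of a rooted `δ`-hard-core configuration `S` is `ν'`-matched and `ν' < ν`, then every
  configuration close enough to `S` is `ν`-matched at the root, WITH THE SAME TEMPLATE.  The only subtlety is the sphere `‖y‖ = 4b`:
  an atom of the nearby configuration in the closed `4b`-ball is `ε`-close to an atom of `S` of norm `≤ 4b + ε`, which is constrained
  only if its norm is `≤ 4b` — guaranteed by choosing `ε` below the norm gap of the finitely many atoms of `S` near the sphere
  (`exists_gap_on`, `finite_inter_of_separated`);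
* `isOpen_setOf_exists_matchedAt_lt` — `{S | ∃ ν' < ν, matchedAt ν' (count|S) 0}` is OPEN;
* `closure_setOf_not_matchedAt_subset` — `closure {S | ¬ matchedAt ν (count|S) 0} ⊆ {S | ¬ matchedAt ν' (count|S) 0}` for `ν' < ν`
  (the form used by the portmanteau step of `GapTransfer`).

Filed `--supports stmt-AtomisticToContinuum-26636` (helper, DEF-FREE).  [folklore]-level bookkeeping; axioms standard.
-/

noncomputable section

namespace Summit.AtomisticToContinuum.Crystallization.Theorems.ChartedPlanarOrderMatchedRootBorel

open MeasureTheory Metric Set Filter Topology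
open Literature.MathematicalPhysics.StatisticalMechanics
open Literature.Probability.Process
open Summit.AtomisticToContinuum.Crystallization.Theorems.ChartedPlanarOrderRigidityDoor

/-- **Matching at a smaller tolerance persists, at the larger tolerance, in a neighbourhood** (same scale, frame, word and heights).
[this work] -/
theorem eventually_matchedAt_of_lt {δ : ℝ} (hδ : 0 < δ) {ν' ν : ℝ} (hν : ν' < ν)
    (S : LocalConfig.RootedHardCoreConfig E3 δ) (hS : matchedAt ν' (S.1 : LocalConfig E3).toMeasure 0) :
    ∀ᶠ T in 𝓝 S, matchedAt ν (T.1 : LocalConfig E3).toMeasure 0 := by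
  classical
  have hsep := S.2.2
  have hsing : ∀ (U : LocalConfig E3) (y : E3), U.toMeasure {y} ≠ 0 ↔ y ∈ (U : Set E3) := fun U y => by
    rw [LocalConfig.toMeasure_def]; exact count_restrict_singleton_ne_zero_iff _ y
  obtain ⟨b, hb, hb1, A, s, z, hs, hgap, hz0, h1, h2⟩ := hS
  -- norm gap above `4b` among the atoms of `S`
  have hfinA : {y : E3 | y ∈ ((S.1 : LocalConfig E3) : Set E3) ∧ ‖y‖ ≤ 4 * b + 1}.Finite := by
    have hF : (closedBall (0 : E3) (4 * b + 1) ∩ ((S.1 : LocalConfig E3) : Set E3)).Finite :=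
      LocalConfig.finite_inter_of_separated hδ hsep (isCompact_closedBall 0 _)
    exact hF.subset fun y hy => ⟨mem_closedBall_zero_iff.mpr hy.2, hy.1⟩
  obtain ⟨ε₁, hε₁, hgap₁⟩ := exists_gap_on _ (fun y : E3 => ‖y‖) (4 * b) hfinA
  set ε : ℝ := min (ε₁ / 2) ((ν - ν') / 2) with hεdef
  have hε : 0 < ε := lt_min (by linarith) (by linarith)
  have hεε₁ : ε ≤ ε₁ / 2 := min_le_left _ _
  have hεν : ε ≤ (ν - ν') / 2 := min_le_right _ _
  set R : ℝ := 5 * b + |ν'| + 1 with hRdef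
  -- local matching in a neighbourhood of `S`
  have hbasic : ∀ᶠ (T' : LocalConfig E3) in 𝓝 (S.1 : LocalConfig E3),
      LocallyMatches R ε ((S.1 : LocalConfig E3) : Set E3) (T' : Set E3) :=
    (LocalConfig.tendsto_iff_locallyMatches (u := (id : LocalConfig E3 → LocalConfig E3))
      (S := (S.1 : LocalConfig E3))).1 tendsto_id R ε hε
  have hnbhd : ∀ᶠ T in 𝓝 S, LocallyMatches R ε ((S.1 : LocalConfig E3) : Set E3) ((T.1 : LocalConfig E3) : Set E3) :=
    (continuous_subtype_val.tendsto S).eventually hbasic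
  filter_upwards [hnbhd] with T hT
  refine ⟨b, hb, hb1, A, s, z, hs, hgap, hz0, ?_, ?_⟩
  · -- atoms of `T` in the closed `4b`-ball
    intro y hyd hyμ
    have hyT : y ∈ ((T.1 : LocalConfig E3) : Set E3) := (hsing _ y).mp hyμ
    have hyn : ‖y‖ ≤ R := by
      rw [dist_zero_right] at hyd
      have : 0 ≤ |ν'| := abs_nonneg _
      linarith
    obtain ⟨y₀, hy₀S, hd₀⟩ := hT.1 y hyT hyn
    have hy₀n : ‖y₀‖ ≤ 4 * b := by
      refine hgap₁ y₀ hy₀S ?_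
      have := norm_le_norm_add_dist' y y₀
      rw [dist_comm] at this
      rw [dist_zero_right] at hyd
      linarith
    obtain ⟨y', hy', hd'⟩ := h1 y₀ (by rwa [dist_zero_right]) ((hsing _ y₀).mpr hy₀S)
    refine ⟨y', hy', ?_⟩
    have := dist_triangle y y₀ y'
    rw [dist_comm] at hd₀
    linarith
  · -- template points in the closed `5b`-ball
    intro y' hy' hd'
    obtain ⟨y₀, hy₀μ, hd₀⟩ := h2 y' hy' hd'
    have hy₀S : y₀ ∈ ((S.1 : LocalConfig E3) : Set E3) := (hsing _ y₀).mp hy₀μ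
    have hy₀n : ‖y₀‖ ≤ R := by
      have h1' := norm_le_norm_add_dist' y' y₀
      rw [dist_comm] at h1'
      rw [dist_zero_right] at hd'
      have : ν' ≤ |ν'| := le_abs_self _
      linarith
    obtain ⟨y, hyT, hdy⟩ := hT.2 y₀ hy₀S hy₀n
    refine ⟨y, (hsing _ y).mpr hyT, ?_⟩
    have := dist_triangle y y₀ y'
    rw [dist_comm] at hdy
    linarith

/-- **The strictly-matched event is open**: `{S | ∃ ν' < ν, matchedAt ν' (count|S) 0}` is open in the local rubber topology. [this work] -/
theorem isOpen_setOf_exists_matchedAt_lt {δ : ℝ} (hδ : 0 < δ) (ν : ℝ) :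
    IsOpen {S : LocalConfig.RootedHardCoreConfig E3 δ | ∃ ν' : ℝ, ν' < ν ∧ matchedAt ν' (S.1 : LocalConfig E3).toMeasure 0} := by
  rw [isOpen_iff_mem_nhds]
  rintro S ⟨ν', hν', hS⟩
  obtain ⟨ν'', h1, h2⟩ := exists_between hν'
  filter_upwards [eventually_matchedAt_of_lt hδ h1 S hS] with T hT
  exact ⟨ν'', h2, hT⟩

/-- **Portmanteau form**: for `ν' < ν`, `closure {S | ¬ matchedAt ν (count|S) 0} ⊆ {S | ¬ matchedAt ν' (count|S) 0}`. [this work] -/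
theorem closure_setOf_not_matchedAt_subset {δ : ℝ} (hδ : 0 < δ) {ν' ν : ℝ} (hν : ν' < ν) :
    closure {S : LocalConfig.RootedHardCoreConfig E3 δ | ¬ matchedAt ν (S.1 : LocalConfig E3).toMeasure 0} ⊆
      {S | ¬ matchedAt ν' (S.1 : LocalConfig E3).toMeasure 0} := by
  intro S hS hS'
  rw [mem_closure_iff_nhds] at hS
  obtain ⟨U, hU, hUmatch⟩ := (eventually_matchedAt_of_lt hδ hν S hS').exists_mem
  obtain ⟨T, hTU, hTbad⟩ := hS U hU
  exact hTbad (hUmatch T hTU)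

/-- the matched-root event at tolerance `ν` contains the open strictly-matched event and is contained in its closure's complement form:
`{∃ ν' < ν, matched_ν'} ⊆ {matched_ν}` (monotonicity, for the record). [folklore] -/
theorem setOf_exists_matchedAt_lt_subset (δ ν : ℝ) :
    {S : LocalConfig.RootedHardCoreConfig E3 δ | ∃ ν' : ℝ, ν' < ν ∧ matchedAt ν' (S.1 : LocalConfig E3).toMeasure 0} ⊆
      {S | matchedAt ν (S.1 : LocalConfig E3).toMeasure 0} := by
  rintro S ⟨ν', hν', hS⟩
  exact matchedAt_mono hν'.le hS

end Summit.AtomisticToContinuum.Crystallization.Theorems.ChartedPlanarOrderMatchedRootBorel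

end
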